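import Summits.KontsevichZagierPeriods.KontsevichZagierPeriods.Theorems.IsometryMove.Negative.Kit

/-!
# `IsometryMove` (stmt-KontsevichZagierPeriods-3471) — IV: the Jacobian identity and the inverse, kernel-checked

Why the refutations of `Negative/LoadBearing|Tightness` are sharp, as polynomial identities:
with `P₁ + iP₂ = (aw+b)·conj(cw+d) + a·conj(c)·t²`, `N = |cw+d|² + |c|²t²` (`w = x + iεy`) and
`M_ij = ∂ⱼPᵢ·N − Pᵢ·∂ⱼN` (`P₃ = t`), `JParams.det_M_eq : det M = ε·|ad − bc|²·N³`, i.e.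
`det Dg = ε (g₃/t)³` for EVERY real `ε` (so `|det Dg| = (g₃/t)³` iff `|ε| = 1`), via the generic
rank-one determinant lemma `det_rank_one_generic` and the degree-11 identity
`JParams.jacobian_reduced`. `JParams.left_inverse_pos/neg`: `g_B ∘ g_A = id` on `{t > 0}` with
`B = (d, −b; −c, a)` (`ε = 1`) resp. `B̄` (`ε = −1`). Dictionary to the typed formula:
`den_eq_N`, `num_re_eq_P₁`, `num_im_eq_P₂`, `normSq_det_eq`; `den_pos`, `height_pos`.
DEAD END recorded for provers: the monolithic degree-23 identity is closed by `ring` but its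
proof term is rejected by the kernel (memory) — factor as here. [Benedetti–Petronio 1992, §A.4]
-/

noncomputable section

open MeasureTheory Set MvPolynomial intervalIntegral
open Literature.NumberTheory.Transcendental Literature.ModelTheory.ExponentialFields

namespace Summit.KontsevichZagierPeriods.HyperbolicBloch.IsometryMoveNegative

open Summit.KontsevichZagierPeriods.KontsevichZagierPeriods (Theses.HyperbolicBloch.IsometryMove)

/-! ## §7 Positive by-product for provers: the Jacobian identity, KERNEL-CHECKED

`det M = ε · |ad − bc|² · N³` where `M_ij = (∂ⱼPᵢ)·N − Pᵢ·(∂ⱼN)` is `N²·` the Jacobian matrix of the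
typed map `g = (P₁/N, P₂/N, ‖ad−bc‖·t/N)` with the factor `‖ad − bc‖` taken out of row 3; hence
`det Dg = ‖ad−bc‖ · det M / N⁶ = ε · (‖ad−bc‖/N)³ = ε · (g₃/t)³` for EVERY real `ε` — the move's
integrand condition `t⁻³ = g₃⁻³·|det Dg|` holds iff `|ε| = 1` (cf. `not_isometryMoveAtEps`).
DEAD END recorded: the monolithic identity (degree 23, 3380 monomials) IS closed by `ring` in
≈ 3 min of elaboration but the KERNEL rejects the proof term ("excessive memory consumption").
The route that type-checks: the rank-one determinant lemma `det(nA − u vᵀ) = n³ det A − n² vᵀadj(A)u`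
(generic, 16 letters, `ring`) reduces it to the degree-11 identity `jacobian_reduced` (`ring`,
180 monomials a side), assembled by `linear_combination`. The dictionary with the typed
`num`/`den` is `den_eq_N`, `num_re_eq_P₁`, `num_im_eq_P₂`, `normSq_det_eq`. The nine entries
`P₁x … Nt` ARE the partial derivatives of `P₁, P₂, N` (first-year calculus; checked symbolically in
`compute/jacobian_identity_purepy.py`; the `HasFDerivAt` bookkeeping is left to the prover). -/

/-- Generic rank-one update of a scaled `3 × 3` determinant:
`det(n·A − u vᵀ) = n³·det A − n²·(vᵀ adj(A) u)`, written out entrywise. [folklore] -/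
theorem det_rank_one_generic (n a11 a12 a13 a21 a22 a23 a31 a32 a33 u1 u2 u3 v1 v2 v3 : ℝ) :
    (a11 * n - u1 * v1) * ((a22 * n - u2 * v2) * (a33 * n - u3 * v3) - (a23 * n - u2 * v3) * (a32 * n - u3 * v2))
      - (a12 * n - u1 * v2) * ((a21 * n - u2 * v1) * (a33 * n - u3 * v3) - (a23 * n - u2 * v3) * (a31 * n - u3 * v1))
      + (a13 * n - u1 * v3) * ((a21 * n - u2 * v1) * (a32 * n - u3 * v2) - (a22 * n - u2 * v2) * (a31 * n - u3 * v1))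
    = n ^ 3 * (a11 * (a22 * a33 - a23 * a32) - a12 * (a21 * a33 - a23 * a31) + a13 * (a21 * a32 - a22 * a31))
      - n ^ 2 * (-(a23 * a32 * u1 * v1) + a23 * a31 * u1 * v2 + a22 * a33 * u1 * v1 - a22 * a31 * u1 * v3
          - a21 * a33 * u1 * v2 + a21 * a32 * u1 * v3 + a13 * a32 * u2 * v1 - a13 * a31 * u2 * v2
          - a13 * a22 * u3 * v1 + a13 * a21 * u3 * v2 - a12 * a33 * u2 * v1 + a12 * a31 * u2 * v3
          + a12 * a23 * u3 * v1 - a12 * a21 * u3 * v3 + a11 * a33 * u2 * v2 - a11 * a32 * u2 * v3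
          - a11 * a23 * u3 * v2 + a11 * a22 * u3 * v3) := by
  ring

/-- The twelve real letters of the Jacobian computation: `a = ar + i ai`, …, `d = dr + i di`,
the point `(x, y, t)` and the reflection parameter `ε`. [folklore] -/
structure JParams where
  (ar ai br bi cr ci dr di x y t ε : ℝ)

namespace JParams

variable (q : JParams)

/-- `U + iV = a·w + b`, `w = x + iεy`. [folklore] -/
def U : ℝ := q.ar * q.x - q.ai * (q.ε * q.y) + q.br
/-- `U + iV = a·w + b`. [folklore] -/
def V : ℝ := q.ai * q.x + q.ar * (q.ε * q.y) + q.bi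
/-- `S + iT = c·w + d`. [folklore] -/
def S : ℝ := q.cr * q.x - q.ci * (q.ε * q.y) + q.dr
/-- `S + iT = c·w + d`. [folklore] -/
def T : ℝ := q.ci * q.x + q.cr * (q.ε * q.y) + q.di
/-- `N = |cw + d|² + |c|² t²`. [folklore] -/
def N : ℝ := q.S ^ 2 + q.T ^ 2 + (q.cr ^ 2 + q.ci ^ 2) * q.t ^ 2
/-- `P₁ = Re((aw+b)·conj(cw+d) + a conj(c) t²)`. [folklore] -/
def P₁ : ℝ := q.U * q.S + q.V * q.T + (q.ar * q.cr + q.ai * q.ci) * q.t ^ 2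
/-- `P₂ = Im((aw+b)·conj(cw+d) + a conj(c) t²)`. [folklore] -/
def P₂ : ℝ := q.V * q.S - q.U * q.T + (q.ai * q.cr - q.ar * q.ci) * q.t ^ 2
/-- `∂N/∂x`. [folklore] -/
def Nx : ℝ := 2 * q.S * q.cr + 2 * q.T * q.ci
/-- `∂N/∂y`. [folklore] -/
def Ny : ℝ := -(2 * q.S * q.ci * q.ε) + 2 * q.T * q.cr * q.ε
/-- `∂N/∂t`. [folklore] -/
def Nt : ℝ := 2 * (q.cr ^ 2 + q.ci ^ 2) * q.t
/-- `∂P₁/∂x`. [folklore] -/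
def P₁x : ℝ := q.ar * q.S + q.U * q.cr + q.ai * q.T + q.V * q.ci
/-- `∂P₁/∂y`. [folklore] -/
def P₁y : ℝ := -(q.ai * q.ε) * q.S - q.U * (q.ci * q.ε) + q.ar * q.ε * q.T + q.V * (q.cr * q.ε)
/-- `∂P₁/∂t`. [folklore] -/
def P₁t : ℝ := 2 * (q.ar * q.cr + q.ai * q.ci) * q.t
/-- `∂P₂/∂x`. [folklore] -/
def P₂x : ℝ := q.ai * q.S + q.V * q.cr - q.ar * q.T - q.U * q.ci
/-- `∂P₂/∂y`. [folklore] -/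
def P₂y : ℝ := q.ar * q.ε * q.S - q.V * (q.ci * q.ε) + q.ai * q.ε * q.T - q.U * (q.cr * q.ε)
/-- `∂P₂/∂t`. [folklore] -/
def P₂t : ℝ := 2 * (q.ai * q.cr - q.ar * q.ci) * q.t
/-- `Re(ad − bc)`. [folklore] -/
def Δre : ℝ := q.ar * q.dr - q.ai * q.di - (q.br * q.cr - q.bi * q.ci)
/-- `Im(ad − bc)`. [folklore] -/
def Δim : ℝ := q.ar * q.di + q.ai * q.dr - (q.br * q.ci + q.bi * q.cr)

/-- The reduced (degree-11) Jacobian identity: `N·det(∂P) − vᵀ adj(∂P) u = ε |ad − bc|² N` with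
`A = ∂P` (third row `(0,0,1)`), `u = (P₁, P₂, t)`, `v = ∇N`. [folklore] -/
theorem jacobian_reduced :
    q.N * (q.P₁x * q.P₂y - q.P₁y * q.P₂x)
      - (q.P₂y * q.P₁ * q.Nx - q.P₂x * q.P₁ * q.Ny - q.P₁y * q.P₂ * q.Nx + q.P₁x * q.P₂ * q.Ny
        + q.t * (-(q.P₁t * q.P₂y * q.Nx) + q.P₁t * q.P₂x * q.Ny + q.P₁y * q.P₂t * q.Nx
          - q.P₁y * q.P₂x * q.Nt - q.P₁x * q.P₂t * q.Ny + q.P₁x * q.P₂y * q.Nt))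
    = q.ε * (q.Δre ^ 2 + q.Δim ^ 2) * q.N := by
  simp only [N, P₁x, P₂y, P₁y, P₂x, P₁, P₂, Nx, Ny, Nt, P₁t, P₂t, Δre, Δim, U, V, S, T]
  ring

/-- **The Jacobian identity of the typed Poincaré extension**: with `M_ij = ∂ⱼPᵢ·N − Pᵢ·∂ⱼN`
(`P₃ = t`), `det M = ε·|ad − bc|²·N³`; equivalently `det Dg = ε (g₃/t)³`. [folklore] -/
theorem det_M_eq :
    (q.P₁x * q.N - q.P₁ * q.Nx) * ((q.P₂y * q.N - q.P₂ * q.Ny) * (1 * q.N - q.t * q.Nt)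
        - (q.P₂t * q.N - q.P₂ * q.Nt) * (0 * q.N - q.t * q.Ny))
      - (q.P₁y * q.N - q.P₁ * q.Ny) * ((q.P₂x * q.N - q.P₂ * q.Nx) * (1 * q.N - q.t * q.Nt)
        - (q.P₂t * q.N - q.P₂ * q.Nt) * (0 * q.N - q.t * q.Nx))
      + (q.P₁t * q.N - q.P₁ * q.Nt) * ((q.P₂x * q.N - q.P₂ * q.Nx) * (0 * q.N - q.t * q.Ny)
        - (q.P₂y * q.N - q.P₂ * q.Ny) * (0 * q.N - q.t * q.Nx))
    = q.ε * (q.Δre ^ 2 + q.Δim ^ 2) * q.N ^ 3 := by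
  have hA := det_rank_one_generic q.N q.P₁x q.P₁y q.P₁t q.P₂x q.P₂y q.P₂t 0 0 1 q.P₁ q.P₂ q.t
    q.Nx q.Ny q.Nt
  have hB := q.jacobian_reduced
  linear_combination hA + q.N ^ 2 * hB

/-! ### Left inverse (injectivity datum), kernel-checked

For second Möbius data `B = (a_B, b_B, c_B, d_B)` (eight real letters `k`) evaluated at the IMAGE
point `g_A(p) = (P₁/N, P₂/N, |Δ| t/N)` with the same `ε`, every quantity of the typed formula is a
polynomial after scaling by a power of `N`: `N·w' = P₁ + iεP₂`, `N²·t'² = |Δ|²t²`,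
`N·(c_B w' + d_B) = SB + i TB`, `N²·N_B(g_A p) = NB2`, `N²·num_B(g_A p) = numB2re + i numB2im`.
`left_inverse_pos/neg`: for `B = (d, −b; −c, a)` (`ε = 1`) resp. its complex conjugate
(`ε = −1`): `NB2 = |Δ|²N`, `numB2re = x|Δ|²N`, `numB2im = y|Δ|²N` — i.e. wherever `N ≠ 0 ≠ N_B`
(all of `{t > 0}`), `g_B(g_A(p)) = (x|Δ|²N/|Δ|²N, y|Δ|²N/|Δ|²N, |Δ|·(|Δ|t/N)/(|Δ|²/N)) = p`:
the typed map is injective on `{t > 0}` with an inverse IN THE SAME TYPED FAMILY (algebraic data). -/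

/-- Eight real letters of a second Möbius datum `B`. [folklore] -/
structure BParams where
  (ar ai br bi cr ci dr di : ℝ)

/-- `Re(N·(c_B w' + d_B))` at the image point. [folklore] -/
def SB (k : BParams) : ℝ := k.cr * q.P₁ - k.ci * (q.ε * q.P₂) + k.dr * q.N
/-- `Im(N·(c_B w' + d_B))` at the image point. [folklore] -/
def TB (k : BParams) : ℝ := k.ci * q.P₁ + k.cr * (q.ε * q.P₂) + k.di * q.N
/-- `N² · N_B(g_A p)`. [folklore] -/
def NB2 (k : BParams) : ℝ :=
  q.SB k ^ 2 + q.TB k ^ 2 + (k.cr ^ 2 + k.ci ^ 2) * ((q.Δre ^ 2 + q.Δim ^ 2) * q.t ^ 2)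
/-- `Re(N·(a_B w' + b_B))`. [folklore] -/
def AX (k : BParams) : ℝ := k.ar * q.P₁ - k.ai * (q.ε * q.P₂) + k.br * q.N
/-- `Im(N·(a_B w' + b_B))`. [folklore] -/
def AY (k : BParams) : ℝ := k.ai * q.P₁ + k.ar * (q.ε * q.P₂) + k.bi * q.N
/-- `Re(N² · num_B(g_A p))`. [folklore] -/
def numB2re (k : BParams) : ℝ :=
  q.AX k * q.SB k + q.AY k * q.TB k + (k.ar * k.cr + k.ai * k.ci) * ((q.Δre ^ 2 + q.Δim ^ 2) * q.t ^ 2)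
/-- `Im(N² · num_B(g_A p))`. [folklore] -/
def numB2im (k : BParams) : ℝ :=
  q.AY k * q.SB k - q.AX k * q.TB k + (k.ai * k.cr - k.ar * k.ci) * ((q.Δre ^ 2 + q.Δim ^ 2) * q.t ^ 2)

/-- The inverse datum `B = (d, −b; −c, a)` (for `ε = 1`). [folklore] -/
def inv : BParams := ⟨q.dr, q.di, -q.br, -q.bi, -q.cr, -q.ci, q.ar, q.ai⟩
/-- The conjugate inverse datum `B̄ = (d̄, −b̄; −c̄, ā)` (for `ε = −1`: `ρ ∘ ext(B) = ext(B̄) ∘ ρ`). [folklore] -/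
def invConj : BParams := ⟨q.dr, -q.di, -q.br, q.bi, -q.cr, q.ci, q.ar, -q.ai⟩

/-- **Left inverse, `ε = 1`:** `g_{(d,−b;−c,a),1} ∘ g_{(a,b;c,d),1} = id` in polynomial form. [folklore] -/
theorem left_inverse_pos (h : q.ε = 1) :
    q.NB2 q.inv = (q.Δre ^ 2 + q.Δim ^ 2) * q.N ∧
      q.numB2re q.inv = q.x * (q.Δre ^ 2 + q.Δim ^ 2) * q.N ∧
      q.numB2im q.inv = q.y * (q.Δre ^ 2 + q.Δim ^ 2) * q.N := by
  refine ⟨?_, ?_, ?_⟩ <;>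
    simp only [NB2, numB2re, numB2im, SB, TB, AX, AY, inv, N, P₁, P₂, Δre, Δim, U, V, S, T, h] <;>
    ring

/-- **Left inverse, `ε = −1`:** `g_{B̄,−1} ∘ g_{A,−1} = id`, `B̄ = (d̄,−b̄;−c̄,ā)`, in polynomial form. [folklore] -/
theorem left_inverse_neg (h : q.ε = -1) :
    q.NB2 q.invConj = (q.Δre ^ 2 + q.Δim ^ 2) * q.N ∧
      q.numB2re q.invConj = q.x * (q.Δre ^ 2 + q.Δim ^ 2) * q.N ∧
      q.numB2im q.invConj = q.y * (q.Δre ^ 2 + q.Δim ^ 2) * q.N := by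
  refine ⟨?_, ?_, ?_⟩ <;>
    simp only [NB2, numB2re, numB2im, SB, TB, AX, AY, invConj, N, P₁, P₂, Δre, Δim, U, V, S, T,
      h] <;>
    ring

/-- The parameters of the crux data `(a, b, c, d, ε)` at a point `p`. [folklore] -/
def ofCrux (a b c d : ℂ) (ε : ℝ) (p : Fin 3 → ℝ) : JParams :=
  ⟨a.re, a.im, b.re, b.im, c.re, c.im, d.re, d.im, p 0, p 1, p 2, ε⟩

end JParams

/-- Dictionary: the typed denominator is `N`. [folklore] -/
theorem den_eq_N (a b c d : ℂ) (ε : ℝ) (p : Fin 3 → ℝ) :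
    den c d ε p = (JParams.ofCrux a b c d ε p).N := by
  simp [den, JParams.ofCrux, JParams.N, JParams.S, JParams.T, Complex.normSq_apply]
  ring

/-- Dictionary: the real part of the typed numerator is `P₁`. [folklore] -/
theorem num_re_eq_P₁ (a b c d : ℂ) (ε : ℝ) (p : Fin 3 → ℝ) :
    (num a b c d ε p).re = (JParams.ofCrux a b c d ε p).P₁ := by
  have h2 : ((p 2 : ℝ) : ℂ) ^ 2 = ((p 2 ^ 2 : ℝ) : ℂ) := by push_cast; ring
  simp only [num, h2]
  simp [-Complex.ofReal_pow, JParams.ofCrux, JParams.P₁, JParams.U, JParams.V, JParams.S, JParams.T,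
    Complex.mul_re, Complex.mul_im]
  ring

/-- Dictionary: the imaginary part of the typed numerator is `P₂`. [folklore] -/
theorem num_im_eq_P₂ (a b c d : ℂ) (ε : ℝ) (p : Fin 3 → ℝ) :
    (num a b c d ε p).im = (JParams.ofCrux a b c d ε p).P₂ := by
  have h2 : ((p 2 : ℝ) : ℂ) ^ 2 = ((p 2 ^ 2 : ℝ) : ℂ) := by push_cast; ring
  simp only [num, h2]
  simp [-Complex.ofReal_pow, JParams.ofCrux, JParams.P₂, JParams.U, JParams.V, JParams.S, JParams.T,
    Complex.mul_re, Complex.mul_im]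
  ring

/-- Dictionary: `|ad − bc|² = Δre² + Δim²` (so `‖ad − bc‖ = √(Δre² + Δim²)`). [folklore] -/
theorem normSq_det_eq (a b c d : ℂ) (ε : ℝ) (p : Fin 3 → ℝ) :
    Complex.normSq (a * d - b * c) =
      (JParams.ofCrux a b c d ε p).Δre ^ 2 + (JParams.ofCrux a b c d ε p).Δim ^ 2 := by
  simp [JParams.ofCrux, JParams.Δre, JParams.Δim, Complex.normSq_apply, Complex.mul_re,
    Complex.mul_im]
  ring

/-- `N > 0` on the open upper half-space as soon as `ad − bc ≠ 0` (so all divisions in the typed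
formula, in `det_M_eq` and in `left_inverse_pos/neg` are genuine there). [folklore] -/
theorem den_pos {a b c d : ℂ} (hdet : a * d - b * c ≠ 0) (ε : ℝ) {p : Fin 3 → ℝ}
    (hp : 0 < p 2) : 0 < den c d ε p := by
  unfold den
  by_cases hc : c = 0
  · subst hc
    have hd : d ≠ 0 := by
      rintro rfl
      exact hdet (by ring)
    simpa using Complex.normSq_pos.mpr hd
  · have h1 : 0 ≤ Complex.normSq (c * (Complex.mk (p 0) (ε * p 1)) + d) := Complex.normSq_nonneg _
    have h2 : 0 < Complex.normSq c * p 2 ^ 2 :=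
      mul_pos (Complex.normSq_pos.mpr hc) (pow_pos hp 2)
    linarith

/-- The height `g₃ = ‖ad − bc‖ t / N` of the typed map is positive on `{t > 0}`: `g` preserves the
open upper half-space. [folklore] -/
theorem height_pos {a b c d : ℂ} (hdet : a * d - b * c ≠ 0) (ε : ℝ) {p : Fin 3 → ℝ}
    (hp : 0 < p 2) : 0 < ‖a * d - b * c‖ * p 2 / den c d ε p :=
  div_pos (mul_pos (norm_pos_iff.mpr hdet) hp) (den_pos hdet ε hp)

end Summit.KontsevichZagierPeriods.HyperbolicBloch.IsometryMoveNegative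

end
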